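import Summits.Schanuel.Schanuel.Theorems.RootDecomp1KHeightMachine04

/-!
# RootDecomp1KHeightMachine — lens 1, generation 53, NODE 13 «THE HEIGHT MACHINE ON THE LINE: node 12's antecedent DISCHARGED, HYPOTHESIS-FREE, on the two ℙ¹-uniformised territory classes» (RULE K-R42 (vii′), K-R44) — continuation (RootDecomp1KHeightMachine05): §6 the class-II member R13 and its costume test, §7 the residual RE-GRADED

(lens-1 g53 NODE 13 HOME kernel K = HOME/decomp-schanuel-lens-1/g53/HeightMachine.lean eb09d600…, 1515 l, 171 thm + 12 def, imports tree …RootDecomp1KHeightGrading04 + Literature.NumberTheory.DiophantineGeometry.RationalFunctionHeight ONLY; Probe / Ctrl0 / Ctrl + NODE-g53.md + SHA256SUMS + the lens's K-R44 certificate g53/liveness/ (census instrument liveness3.py); CLAIM L2587, crit EX-ANTE PRICE L2588 (ONE THEOREM ×1 under RULE K-R42 (vii′) «an infinite territory class becomes UNCONDITIONAL» iff CHECKLIST K-g53; RULE K-R44 liveness certificate), NODE L2595 / REQUEST L2596, census STAGING NOTE 3 L2597 + CONFIRM L2598 (L13 liveness row; dedup pre-scan 0 homonyms), critic VERDICT L2599: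 CLEARED — THEOREM ×1 under RULE K-R42 (vii′) (A⁺ ∧ A′ jointly; the (P2) label earned inside the credit by L13); CHECKLIST K-g53 met; RULE K-R44 fixed with the census instrument LIVENESS-v3 as certificate format; PORT GO (credit port, verbatim; conditions: dedup scan clean, provenance block, cite-token spelling). Port by census-1 gen 22 as `RootDecomp1KHeightMachine01–05` (`--supports stmt-Schanuel-33364`; no census credit): 01 = §1 the INPUT `exists_logHt_div_sub_le` (Silverman AEC VIII.5.6 on ℙ¹ over ℚ — the tree's PROVED Literature theorem `exists_abs_logHeight₁_div_sub_le_finrank` at k = K = ℚ through node 12's `logHt_eq_logHeight₁`; NO binder, NO hypothesis def) + §2 the two transfer tails (`clause_of_transfer`, `not_clause_of_transfer(_le)`, boundary tail `not_clause_of_upper_height_le`); 02 = §3 CLASS I correspondence curves **`thinFibreAt_of_corr`** (A⁺) / `thinFibreAt_iff_bddLevelEmpty_of_corr(_le)` (B⁺, B⁼) / `thinFibreAt_or_iff_bddLevelEmpty_of_corr` + `CorrAt`, `corrP` + §4 CLASS II ℚ-parametrised curves **`thinFibreAt_of_param`** (A′) / B′ / B′⁼ + `ParamAt`; 03 = §5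 the class-I member `M13` (illustration; costume test at m₀ = 2, 3); 04 = §5b the LIVE class-I member `L13` (K-R44 certificate LIFTS; costume test); 05 = §6 the class-II member `R13` (x = t³ + t, y = t + 1/t; LIFTS, exp 1/3) + §7 the residual of record RE-GRADED ×0 (`MachineDecidedAt`, `MachineOffAt`, `MachineHeightOffAt`, `thinFibre_of_machineOffAt`, …). PORT EDITS: none needed on decls (K fully documented, no private, no set_option, no cite-token); provenance doc blocks + continuation headers = K's own open-lines only; statements and proofs VERBATIM. Rung 0 — nothing here proves Schanuel, 33364, 33363, 31077 or ThinFibre 2; classes I/II are HYPOTHESIS-FREE, the rest of §7 is conditional on PadicSubspace / HeightComparison.)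
-/

noncomputable section

namespace Summit.Schanuel.Schanuel.Theorems.RootDecomp1KHeightMachine

open Polynomial LiouvilleNumber
open scoped Nat
open Summit.Schanuel.Schanuel.Theorems.RootDecomp1KSkelCell (SkelLiouvilleFix)
open Summit.Schanuel.Schanuel.Theorems.RootDecomp1KTwoBaseCell (psNumer partialSum_eq_psNumer_div coprime_psNumer
  partialSum_pos' partialSum_lt_two)
open Summit.Schanuel.Schanuel.Theorems.RootDecomp1KDegreeLadder
open Summit.Schanuel.Schanuel.Theorems.RootDecomp1KXLinearCore
open Summit.Schanuel.Schanuel.Theorems.RootDecomp1KXLinear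
open Summit.Schanuel.Schanuel.Theorems.RootDecomp1KXLinearII
open Summit.Schanuel.Schanuel.Theorems.RootDecomp1KXTop
open Summit.Schanuel.Schanuel.Theorems.RootDecomp1KXAll
open Summit.Schanuel.Schanuel.Theorems.RootDecomp1KLevelFinite
open Summit.Schanuel.Schanuel.Theorems.RootDecomp1KSubspaceBranch
open Summit.Schanuel.Schanuel.Theorems.RootDecomp1KHeightGrading

/-! ### §6  The class-II member `R13 = x² − (Y³ − 2Y)·x + Y²` (`x = t³ + t`, `y = (t² + 1)/t`; `dφ = 3 < 2·2 = m₀·dψ`)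
and its COSTUME TEST BY NAME -/

/-- the `x`-coefficients of `R13`: `c₂ = 1` (CONSTANT top: the point `(∞, ∞)` has order `e = 3`), `c₁ = −(Y³ − 2Y)`,
`c₀ = Y²`. -/
def r13C : ℕ → ℤ[X] := fun j => if j = 2 then 1 else if j = 1 then -(X ^ 3 - Polynomial.C 2 * X) else X ^ 2

/-- **THE CLASS-II MEMBER** `R13 = x² − (Y³ − 2Y)·x + Y² ∈ ℤ[x][Y]`: `xdeg = 2`, `deg_Y = 3`; the rational curve
`x = t³ + t`, `y = (t² + 1)/t` (inverse `t = (x + y)/y²`). -/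
def R13 : ℤ[X][X] := xPolyP 2 r13C

/-- `r13C 2 = 1`. -/
theorem r13C_two : r13C 2 = 1 := by simp [r13C]
/-- `r13C 1 = -(X ^ 3 - C 2 * X)`. -/
theorem r13C_one : r13C 1 = -(X ^ 3 - Polynomial.C 2 * X) := by simp [r13C]
/-- `r13C 0 = X ^ 2`. -/
theorem r13C_zero : r13C 0 = X ^ 2 := by simp [r13C]
/-- `{j : ℕ} (hj : 3 ≤ j) : r13C j = X ^ 2` (unused indices). -/
theorem r13C_of_ge {j : ℕ} (hj : 3 ≤ j) : r13C j = X ^ 2 := by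
  simp [r13C, show j ≠ 2 by omega, show j ≠ 1 by omega]

/-- `(r13C 2).natDegree = 0`. -/
theorem natDegree_r13C_two : (r13C 2).natDegree = 0 := by rw [r13C_two, natDegree_one]
/-- `(r13C 1).natDegree = 3`. -/
theorem natDegree_r13C_one : (r13C 1).natDegree = 3 := by rw [r13C_one, natDegree_neg]; compute_degree!
/-- `(r13C 0).natDegree = 2`. -/
theorem natDegree_r13C_zero : (r13C 0).natDegree = 2 := by rw [r13C_zero, natDegree_X_pow]
/-- `r13C 2 ≠ 0`. -/
theorem r13C_two_ne_zero : r13C 2 ≠ 0 := by rw [r13C_two]; exact one_ne_zero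

/-- `(j : ℕ) : (r13C j).natDegree ≤ 3`. -/
theorem natDegree_r13C_le (j : ℕ) : (r13C j).natDegree ≤ 3 := by
  rcases Nat.lt_or_ge j 3 with hj | hj
  · interval_cases j
    · rw [natDegree_r13C_zero]; norm_num
    · rw [natDegree_r13C_one]
    · rw [natDegree_r13C_two]; norm_num
  · rw [r13C_of_ge hj, natDegree_X_pow]; norm_num

/-- NO `x`-exponent of `R13` is missing (`c_j(1) = 1, 1, 1`). -/
theorem r13C_ne_zero {j : ℕ} (hj : j ≤ 2) : r13C j ≠ 0 := by
  intro h
  have h0 := congrArg (fun q : ℤ[X] => q.eval 1) h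
  interval_cases j <;> simp [r13C_zero, r13C_one, r13C_two] at h0

/-- `xdeg R13 = 2`. -/
theorem xdeg_R13 : xdeg R13 = 2 := xdeg_xPolyP 2 r13C r13C_two_ne_zero

/-- `topX R13 = 1`. -/
theorem topX_R13 : topX R13 = r13C 2 := topX_xPolyP 2 r13C r13C_two_ne_zero

/-- the `x¹Y³`-coefficient of `R13` is `−1`. -/
theorem coeff_coeff_R13_three_one : (R13.coeff 3).coeff 1 = -1 := by
  rw [R13, coeff_coeff_xPolyP, if_pos (by simp), r13C_one, coeff_neg, coeff_sub, coeff_X_pow, coeff_C_mul, coeff_X]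
  simp

/-- `deg_Y R13 = 3`. -/
theorem natDegree_R13 : R13.natDegree = 3 := by
  refine le_antisymm (natDegree_xPolyP_le 2 r13C 3 fun j _ => natDegree_r13C_le j) ?_
  refine le_natDegree_of_ne_zero fun h => ?_
  have h1 := coeff_coeff_R13_three_one
  rw [h, coeff_zero] at h1
  norm_num at h1

/-- the `x²Y⁰`-coefficient of `R13` is `1`. -/
theorem coeff_coeff_R13_zero_two : (R13.coeff 0).coeff 2 = 1 := by
  rw [R13, coeff_coeff_xPolyP, if_pos (by simp), r13C_two, coeff_one_zero]

/-- `R13` is NOT a two-term curve `x^k·B(Y) − A(Y)`. -/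
theorem R13_ne_twoTermP (k : ℕ) (B A : ℤ[X]) : R13 ≠ twoTermP k B A := by
  intro h
  have h1 := congrArg (fun Q : ℤ[X][X] => (Q.coeff 3).coeff 1) h
  have h2 := congrArg (fun Q : ℤ[X][X] => (Q.coeff 0).coeff 2) h
  simp only [coeff_coeff_R13_three_one, coeff_coeff_R13_zero_two, coeff_coeff_twoTermP] at h1 h2
  split_ifs at h1 h2 <;> omega

/-- `R13` is none of node 12b's bookkept members (`RootDecomp1KHeightGrading04`): `R13 ≠ B17P` (`deg_Y`: `3 ≠ 2`). -/
theorem R13_ne_B17P : R13 ≠ B17P := fun h => by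
  have := natDegree_R13; rw [h, natDegree_B17P] at this; omega

/-- `R13 ≠ N2P` (`deg_Y`: `3 ≠ 2`). -/
theorem R13_ne_N2P : R13 ≠ N2P := fun h => by
  have := natDegree_R13; rw [h, natDegree_N2P] at this; omega

/-- `R13 ≠ cuspP` (`cuspP = Y³ − x²` has no `x¹Y³`-term). -/
theorem R13_ne_cuspP : R13 ≠ cuspP := fun h => by
  have h1 := coeff_coeff_R13_three_one
  rw [h, cuspP, coeff_sub, coeff_C, if_neg (by norm_num), sub_zero, coeff_X_pow, if_pos rfl, coeff_one] at h1
  norm_num at h1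

/-- `R13 ≠ 0`. -/
theorem R13_ne_zero : R13 ≠ 0 := fun h => by have := natDegree_R13; rw [h, natDegree_zero] at this; omega

/-- the evaluation `R13(x, y) = y² − x(y³ − 2y) + x²`. -/
theorem bev_R13 (x y : ℝ) : bev R13 x y = y ^ 2 - x * (y ^ 3 - 2 * y) + x ^ 2 := by
  rw [R13, bev_xPolyP]
  simp [Finset.sum_range_succ, r13C_zero, r13C_one, r13C_two, map_ofNat]
  ring

/-- **the `ℚ`-parametrisation of `R13`**: every rational point with `y ≠ 0` is `(t³ + t, (t² + 1)/t)` with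
`t = (x + y)/y² ∈ ℚ` (and `y = 0` forces `x = 0`, of height `0`).  (`y⁴·(t² − y·t + 1) = R13(x, y)`; then
`ψ(t) = (t² + 1)/t = y` and `φ(t) = t(t² + 1) = y²t − y = x`.) -/
theorem param_R13 (x y : ℚ) (h : bev R13 x y = 0) :
    logHt x ≤ 0 ∨ ∃ t : ℚ, aeval t (X ^ 3 + X : ℚ[X]) / aeval t (1 : ℚ[X]) = x ∧
      aeval t (X ^ 2 + 1 : ℚ[X]) / aeval t (X : ℚ[X]) = y := by
  rw [bev_R13] at h
  have h' : (y ^ 2 - x * (y ^ 3 - 2 * y) + x ^ 2 : ℚ) = 0 := by exact_mod_cast h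
  by_cases hy : y = 0
  · left
    rw [hy] at h'
    have hx : x = 0 := by
      have : x ^ 2 = 0 := by linear_combination h'
      exact pow_eq_zero_iff (two_ne_zero) |>.mp this
    rw [hx, logHt_zero]
  · right
    refine ⟨(x + y) / y ^ 2, ?_, ?_⟩
    all_goals simp only [map_add, map_pow, aeval_X, map_one, div_one]
    · have h1 : (x + y) / y ^ 2 * y ^ 2 = x + y := div_mul_cancel₀ _ (pow_ne_zero 2 hy)
      have h2 : ((x + y) / y ^ 2) ^ 2 - y * ((x + y) / y ^ 2) + 1 = 0 := by
        have e : y ^ 4 * (((x + y) / y ^ 2) ^ 2 - y * ((x + y) / y ^ 2) + 1) =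
            ((x + y) / y ^ 2 * y ^ 2) ^ 2 - y ^ 3 * ((x + y) / y ^ 2 * y ^ 2) + y ^ 4 := by ring
        have e0 : y ^ 4 * (((x + y) / y ^ 2) ^ 2 - y * ((x + y) / y ^ 2) + 1) = 0 := by
          rw [e, h1]; linear_combination h'
        exact (mul_eq_zero.mp e0).resolve_left (pow_ne_zero 4 hy)
      linear_combination ((x + y) / y ^ 2 + y) * h2 + h1
    · have h1 : (x + y) / y ^ 2 * y ^ 2 = x + y := div_mul_cancel₀ _ (pow_ne_zero 2 hy)
      have h2 : ((x + y) / y ^ 2) ^ 2 - y * ((x + y) / y ^ 2) + 1 = 0 := by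
        have e : y ^ 4 * (((x + y) / y ^ 2) ^ 2 - y * ((x + y) / y ^ 2) + 1) =
            ((x + y) / y ^ 2 * y ^ 2) ^ 2 - y ^ 3 * ((x + y) / y ^ 2 * y ^ 2) + y ^ 4 := by ring
        have e0 : y ^ 4 * (((x + y) / y ^ 2) ^ 2 - y * ((x + y) / y ^ 2) + 1) = 0 := by
          rw [e, h1]; linear_combination h'
        exact (mul_eq_zero.mp e0).resolve_left (pow_ne_zero 4 hy)
      have ht0 : (x + y) / y ^ 2 ≠ 0 := by
        intro ht
        rw [ht] at h2
        norm_num at h2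
      rw [div_eq_iff ht0]
      linear_combination h2

/-- `(t² + 1, t)` is a coprime pair over `ℚ`: `1·(t² + 1) − t·t = 1`. -/
theorem isCoprime_psi_R13 : IsCoprime (X ^ 2 + 1 : ℚ[X]) X := ⟨1, -X, by ring⟩

/-- `dφ = max(deg(t³ + t), deg 1) = 3`. -/
theorem dphi_R13 : max (X ^ 3 + X : ℚ[X]).natDegree (1 : ℚ[X]).natDegree = 3 := by
  have h1 : (X ^ 3 + X : ℚ[X]).natDegree = 3 := by compute_degree!
  rw [h1, natDegree_one]; rfl

/-- `dψ = max(deg(t² + 1), deg t) = 2`. -/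
theorem dpsi_R13 : max (X ^ 2 + 1 : ℚ[X]).natDegree (X : ℚ[X]).natDegree = 2 := by
  have h1 : (X ^ 2 + 1 : ℚ[X]).natDegree = 2 := by compute_degree!
  rw [h1, natDegree_X]; rfl

/-- **`R13` IS DECIDED AT EVERY `m₀ ≥ 2`, HYPOTHESIS-FREE** (THEOREM A′: `dφ = 3 < 2·m₀`). -/
theorem thinFibreAt_R13 {m₀ : ℕ} (hm : 2 ≤ m₀) : ThinFibreAt m₀ R13 :=
  thinFibreAt_of_param (isCoprime_one_right (x := (X ^ 3 + X : ℚ[X]))) isCoprime_psi_R13 param_R13 dphi_R13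
    dpsi_R13 (by omega)

/-- `R13 ∈ ParamAt 2`. -/
theorem paramAt_two_R13 : ParamAt 2 R13 :=
  ⟨_, _, _, _, 0, isCoprime_one_right, isCoprime_psi_R13, by rw [dphi_R13, dpsi_R13]; norm_num, param_R13⟩

/-! #### The costume test: `R13` is in NO tree class decided at `m₀ = 2` or `3` and NOT in node 11's class there -/

/-- `¬ R13.natDegree < 3`. -/
theorem not_natDegree_R13_lt_three : ¬ R13.natDegree < 3 := by rw [natDegree_R13]; norm_num

/-- `R13` has NO x-linear presentation (`x`-degree `2`; values `1, 3, 7` at `y = 1`, `x = 0, 1, 2`). -/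
theorem R13_ne_xLinP (A B : ℤ[X]) : R13 ≠ xLinP A B := by
  intro hP
  have h := fun x : ℝ => congrArg (fun Q => bev Q x 1) hP
  simp only [bev_R13, bev_xLinP] at h
  have h0 := h 0
  have h1 := h 1
  have h2 := h 2
  norm_num at h0 h1 h2
  linarith

/-- `¬ XLinearLt R13`. -/
theorem not_xLinearLt_R13 : ¬ XLinearLt R13 := fun ⟨A, B, _, _, hP⟩ => R13_ne_xLinP A B hP

/-- the separable x-linear disjunct fails at every `m₀`. -/
theorem not_xLinear_sep_R13 (m₀ : ℕ) :
    ¬ (3 ≤ m₀ ∧ ∃ A B : ℤ[X], (B.map (Int.castRingHom ℚ)).Separable ∧ R13 = xLinP A B) :=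
  fun ⟨_, A, B, _, hP⟩ => R13_ne_xLinP A B hP

/-- in every presentation `R13 = Σ_{j ≤ k} x^j c_j(Y)` with a top WITHOUT `ℚ₂`-roots, `k = 2`, `c₂ = 1` and
`c₁ = −(Y³ − 2Y)` of degree `3 > deg c₂ + 2`: **`¬ RootlessTop e R13` for `e ≤ 2`** (the point `(∞,∞)` has order `3`). -/
theorem not_rootlessTop_R13 {e : ℕ} (he : e ≤ 2) : ¬ RootlessTop e R13 := by
  rintro ⟨k, c, hdeg, hroot, h⟩
  have hc : ∀ i j : ℕ, (if j ∈ Finset.range 3 then (r13C j).coeff i else 0) =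
      (if j ∈ Finset.range (k + 1) then (c j).coeff i else 0) := by
    intro i j
    rw [← coeff_coeff_xPolyP, ← coeff_coeff_xPolyP, ← R13, h]
  rcases lt_trichotomy k 2 with hk | rfl | hk
  · have h22 := hc 0 2
    rw [if_pos (by simp), if_neg (by simp; omega), r13C_two, coeff_one_zero] at h22
    norm_num at h22
  · have hc2 : c 2 = r13C 2 := by
      ext i
      have := hc i 2
      rw [if_pos (by simp), if_pos (by simp)] at this
      exact this.symm
    have hc1 : c 1 = r13C 1 := by
      ext i
      have := hc i 1
      rw [if_pos (by simp), if_pos (by simp)] at this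
      exact this.symm
    have h1 := hdeg 1 (by norm_num)
    rw [hc1, hc2, natDegree_r13C_one, natDegree_r13C_two] at h1
    omega
  · have hck : c k = 0 := by
      ext i
      have := hc i k
      rw [if_neg (by simp; omega), if_pos (by simp)] at this
      rw [coeff_zero]; exact this.symm
    exact hroot 0 (by rw [hck, map_zero])

/-- for the record: `R13 ∈ RootlessTop 3` (constant top, order `3` at `(∞,∞)`) — the tree's `thinFibreAt_of_rootlessTop`
decides it at `m₀ ≥ 4`, NOT at `m₀ = 2, 3`. -/
theorem rootlessTop_three_R13 : RootlessTop 3 R13 := by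
  refine ⟨2, r13C, fun j hj => ?_, fun z => ?_, rfl⟩
  · rw [natDegree_r13C_two]
    interval_cases j
    · rw [natDegree_r13C_zero]; norm_num
    · rw [natDegree_r13C_one]
  · rw [r13C_two, map_one]; exact one_ne_zero

/-- `muTop R13 = 0` (constant top). -/
theorem muTop_R13 : muTop R13 = 0 := by
  have := muTop_le_natDegree R13
  rw [topX_R13, natDegree_r13C_two] at this
  omega

/-- `eTop R13 = 3` (`deg_Y − deg c₂ = 3 − 0`). -/
theorem eTop_R13 : eTop R13 = 3 := by
  rw [eTop, topX_R13, natDegree_R13, natDegree_r13C_two]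

/-- **the tree's threshold EVALUATED: `thinThreshold R13 = 4`** — `thinFibreAt_all` reaches `R13` only at `m₀ ≥ 4`. -/
theorem thinThreshold_R13 : thinThreshold R13 = 4 := by
  rw [thinThreshold, muTop_R13, eTop_R13]; omega

/-- `¬ thinThreshold R13 ≤ 3`. -/
theorem not_thinThreshold_R13_le_three : ¬ thinThreshold R13 ≤ 3 := by rw [thinThreshold_R13]; norm_num

/-- **`R13` is in NO class decided at `m₀ = 2`.** -/
theorem not_decidedAt_two_R13 : ¬ DecidedAt 2 R13 := by
  rintro (h | h | h | h | h)
  · exact not_natDegree_R13_lt_three (by omega)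
  · exact not_xLinearLt_R13 h
  · exact not_xLinear_sep_R13 2 h
  · exact not_thinThreshold_R13_le_three (by omega)
  · exact not_rootlessTop_R13 (by norm_num) h

/-- **`R13` is in NO class decided at `m₀ = 3` either.** -/
theorem not_decidedAt_three_R13 : ¬ DecidedAt 3 R13 := by
  rintro (h | h | h | h | h)
  · exact not_natDegree_R13_lt_three h
  · exact not_xLinearLt_R13 h
  · exact not_xLinear_sep_R13 3 h
  · exact not_thinThreshold_R13_le_three h
  · exact not_rootlessTop_R13 (by norm_num) h

/-- `R13` is NOT in node 11's subspace class at `m₀ ≤ 3` (`eTop R13 + 1 = 4`). -/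
theorem not_sepTopAt_R13 {m₀ : ℕ} (hm : m₀ ≤ 3) : ¬ SepTopAt m₀ R13 := fun h => by
  have := h.2; rw [eTop_R13] at this; omega

/-- **COSTUME TEST BY NAME, summarised — and the member DECIDED, hypothesis-free**: `R13` lies in the open territory
of record after node 12 at `m₀ = 2` AND `m₀ = 3` (`¬ DecidedAt`, `¬ SepTopAt`, `¬ RootlessTop e` for `e ≤ 2`), and
`ThinFibreAt m₀ R13` HOLDS for every `m₀ ≥ 2` with NO hypothesis. -/
theorem R13_territory :
    ¬ DecidedAt 2 R13 ∧ ¬ DecidedAt 3 R13 ∧ ¬ SepTopAt 2 R13 ∧ ¬ SepTopAt 3 R13 ∧ (∀ e, e ≤ 2 → ¬ RootlessTop e R13) ∧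
      ∀ m₀, 2 ≤ m₀ → ThinFibreAt m₀ R13 :=
  ⟨not_decidedAt_two_R13, not_decidedAt_three_R13, not_sepTopAt_R13 (by norm_num), not_sepTopAt_R13 le_rfl,
    fun _ he => not_rootlessTop_R13 he, fun _ hm => thinFibreAt_R13 hm⟩

/-! ### §7  The residual of record RE-GRADED by the two hypothesis-free classes (bookkeeping, ×0 — said so) -/

/-- [class] definition (census convention): **decided by the height machine at quality `m₀`** — the correspondence
class or the parametrised class (BOTH hypothesis-free). -/
def MachineDecidedAt (m₀ : ℕ) (P : ℤ[X][X]) : Prop := CorrAt m₀ P ∨ ParamAt m₀ P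

/-- the machine class IS decided at `m₀` — NO hypothesis. -/
theorem thinFibreAt_of_machineDecidedAt {m₀ : ℕ} {P : ℤ[X][X]} (h : MachineDecidedAt m₀ P) : ThinFibreAt m₀ P :=
  h.elim thinFibreAt_of_corrAt thinFibreAt_of_paramAt

/-- [residual statement def — NOT proved; census convention] **Siegel's clause OFF everything decided at `m₀` and
OFF the machine class** — demanded only for primes outside `DecidedAt m₀` and outside `MachineDecidedAt m₀`. -/
def MachineOffAt (m₀ : ℕ) : Prop :=
  ∀ P : ℤ[X][X], Prime P → 2 ≤ P.natDegree → ¬ DecidedAt m₀ P → ¬ MachineDecidedAt m₀ P → SiegelClause P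

/-- the weakening, PROVED: `SiegelShapesOffAt m₀ → MachineOffAt m₀`. -/
theorem machineOffAt_of_offAt {m₀ : ℕ} (h : SiegelShapesOffAt m₀) : MachineOffAt m₀ :=
  fun P hP hd hnd _ => h P hP hd hnd

/-- **THE RESIDUAL RE-GRADED, with NO hypothesis binder**: `ThinFibre m₀ ⟸ MachineOffAt m₀` (`m₀ ≥ 2`).
Bookkeeping ×0; no ∀-item moves; the bridges of record untouched. -/
theorem thinFibre_of_machineOffAt {m₀ : ℕ} (hm : 2 ≤ m₀) (hR : MachineOffAt m₀) : ThinFibre m₀ := by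
  refine thinFibre_of_prime hm fun P hP hd => ?_
  by_cases h : DecidedAt m₀ P
  · exact thinFibreAt_of_decidedAt hm hP.ne_zero h
  by_cases h' : MachineDecidedAt m₀ P
  · exact thinFibreAt_of_machineDecidedAt h'
  exact thinFibreAt_of_levelFinite (levelFinite_of_siegelClause (hR P hP hd h h')) m₀

/-- … and the (b)-cell from it. -/
theorem b_of_machineOffAt {m₀ : ℕ} (hm : 2 ≤ m₀) (hR : MachineOffAt m₀) (ρ : ℝ) (hρ : SkelLiouvilleFix m₀ ρ) :
    AlgebraicIndependent ℚ ![((liouvilleNumber 2 : ℝ) : ℂ), (ρ : ℂ)] :=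
  thinFibre_imp_b (by omega) (thinFibre_of_machineOffAt hm hR) ρ hρ

/-- [residual statement def — NOT proved; census convention] the variant keeping node 11's and node 12's conditional
classes too: Siegel's clause OFF `DecidedAt m₀`, OFF `SepTopAt m₀`, OFF `HeightDecidedAt m₀` AND OFF the machine class. -/
def MachineHeightOffAt (m₀ : ℕ) : Prop :=
  ∀ P : ℤ[X][X], Prime P → 2 ≤ P.natDegree → ¬ DecidedAt m₀ P → ¬ SepTopAt m₀ P → ¬ HeightDecidedAt m₀ P →
    ¬ MachineDecidedAt m₀ P → SiegelClause P

/-- the weakening, PROVED: `HeightOffAt m₀ → MachineHeightOffAt m₀`. -/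
theorem machineHeightOffAt_of_heightOffAt {m₀ : ℕ} (h : HeightOffAt m₀) : MachineHeightOffAt m₀ :=
  fun P hP hd hnd hns hnh _ => h P hP hd hnd hns hnh

/-- `ThinFibre m₀ ⟸ PadicSubspace ∧ HeightComparison ∧ MachineHeightOffAt m₀` (`m₀ ≥ 2`; bookkeeping ×0). -/
theorem thinFibre_of_padicSubspace_heightComparison_machine {m₀ : ℕ} (hm : 2 ≤ m₀) (hS : PadicSubspace)
    (hH : HeightComparison) (hR : MachineHeightOffAt m₀) : ThinFibre m₀ := by
  refine thinFibre_of_prime hm fun P hP hd => ?_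
  by_cases h : DecidedAt m₀ P
  · exact thinFibreAt_of_decidedAt hm hP.ne_zero h
  by_cases h' : SepTopAt m₀ P
  · exact thinFibreAt_of_sepTopAt hS hm h'
  by_cases h'' : HeightDecidedAt m₀ P
  · exact thinFibreAt_of_heightDecidedAt hH h''
  by_cases h''' : MachineDecidedAt m₀ P
  · exact thinFibreAt_of_machineDecidedAt h'''
  exact thinFibreAt_of_levelFinite (levelFinite_of_siegelClause (hR P hP hd h h' h'' h''')) m₀

end Summit.Schanuel.Schanuel.Theorems.RootDecomp1KHeightMachine

end
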